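import Mathlib.RingTheory.Etale.Weakly
import Mathlib.RingTheory.Unramified.Field
import Mathlib.RingTheory.Flat.FaithfullyFlat.Basic
import Mathlib.RingTheory.RingHom.FaithfullyFlat
import Mathlib.FieldTheory.IsSepClosed
import Mathlib.LinearAlgebra.TensorProduct.Quotient
import Mathlib.RingTheory.Kaehler.Basic
import Literature.RingTheory.Etale.WeaklyEtaleCancel
import HarnessLib

/-!
# Weakly étale algebras over fields (Stacks 092P, 092Q) and pure kernels of flat surjections

Ingredients of de Jong's proof of Olivier's theorem (Stacks, Tag 092Z) used in the proof of
Bhatt–Scholze Theorem 2.3.4: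

* `exists_mul_eq_self_of_flat_quotient` — **the kernel of a flat surjection is pure**: if `T/I`
  is `T`-flat then every `x ∈ I` satisfies `x = y x` for some `y ∈ I` (Stacks 04PS).
* `formallyUnramified_of_flat_lmul'` — if `B ⊗_A B → B` is flat then `Ω_{B/A} = 0`
  (Stacks 092L).
* `RingHom.Flat.of_comp_faithfullyFlat` — flatness of `A → B` descends along a faithfully flat
  `B → C` (Stacks 0584 with `M = B`), and `weaklyEtale_intermediateField` — intermediate fields
  of a weakly étale field extension are weakly étale (Stacks 092O, proof of 092P).
* over a field `K`, for `B` weakly étale: every principal ideal is generated by an idempotent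
  (`exists_isIdempotentElem_of_weaklyEtale_field`), `B` is reduced
  (`isReduced_of_weaklyEtale_field`), and `B` is a field as soon as its idempotents are trivial
  (`isField_of_weaklyEtale_field`), in particular when `B` is local (Stacks 092F/092I/092Q);
* `isSeparable_of_weaklyEtale_field` — **a weakly étale field extension is separable algebraic**
  (Stacks 092P), hence trivial over a separably closed field
  (`bijective_algebraMap_of_weaklyEtale_of_isSepClosed`, also for local `B`).

## References

* The Stacks Project, Tags 04PS, 092L, 092O, 092P, 092Q, 092F. [StacksProject]
* B. Bhatt, P. Scholze, *The pro-étale topology for schemes*, Astérisque 369 (2015),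
  Prop. 2.3.3 (2), Thm. 2.3.5 (Olivier). [BhattScholze2015]

## Design notes

* Theorems only (D-0026). Mathlib searched/used: `Algebra.WeaklyEtale`,
  `Algebra.FormallyUnramified.isSeparable` (needs `EssFiniteType`, supplied for `K⟮x⟯` by
  `IntermediateField.essFiniteType_iff`), `KaehlerDifferential.ideal`,
  `Ideal.cotangent_subsingleton_iff`, `TensorProduct.quotTensorEquivQuotSMul`,
  `Module.FaithfullyFlat.lTensor_injective_iff_injective`,
  `TensorProduct.AlgebraTensorModule.cancelBaseChange`, `RingHom.Flat.tensorProductMap`,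
  `IsSepClosed.algebraMap_surjective`; reused from the tree:
  `Literature.RingTheory.Etale.flat_algebraMap_of_weaklyEtale_left`. Nothing restated.
-/

universe u

open TensorProduct

namespace Literature.RingTheory.Etale

/-! ### Pure kernels of flat surjections (Stacks 04PS) -/

section Pure

variable {T : Type*} [CommRing T]

/-- **The kernel of a flat surjection is pure**: if `T ⧸ I` is a flat `T`-module then every
`x ∈ I` is of the form `y * x` with `y ∈ I` (tensor the injection `(x) → T` with `T/I`).
[cite: StacksProject, Tag 04PS] -/
theorem exists_mul_eq_self_of_flat_quotient (I : Ideal T) [Module.Flat T (T ⧸ I)] {x : T}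
    (hx : x ∈ I) : ∃ y ∈ I, y * x = x := by
  classical
  let N : Submodule T T := Ideal.span {x}
  have hinj : Function.Injective ((N.subtype).rTensor (T ⧸ I)) :=
    Module.Flat.rTensor_preserves_injective_linearMap _ Subtype.val_injective
  let u : N ⊗[T] (T ⧸ I) := ⟨x, Ideal.subset_span rfl⟩ ⊗ₜ 1
  have hu0 : (N.subtype).rTensor (T ⧸ I) u = 0 := by
    change (x : T) ⊗ₜ[T] (1 : T ⧸ I) = 0
    have : (x : T) ⊗ₜ[T] (1 : T ⧸ I) = (1 : T) ⊗ₜ[T] (x • (1 : T ⧸ I)) := by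
      rw [← TensorProduct.smul_tmul, smul_eq_mul, mul_one]
    rw [this, Algebra.smul_def, mul_one, Ideal.Quotient.algebraMap_eq,
      Ideal.Quotient.eq_zero_iff_mem.2 hx, TensorProduct.tmul_zero]
  have hu : u = 0 := hinj (by rw [hu0, map_zero])
  -- transport to `N ⧸ I • ⊤`
  have hq : (TensorProduct.tensorQuotEquivQuotSMul N I) u = 0 := by rw [hu, map_zero]
  have hq' : (TensorProduct.tensorQuotEquivQuotSMul N I) u =
      Submodule.Quotient.mk (⟨x, Ideal.subset_span rfl⟩ : N) := by
    change (TensorProduct.quotTensorEquivQuotSMul N I) (TensorProduct.comm _ _ _ u) = _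
    simp [u]
  rw [hq'] at hq
  have hmem : (⟨x, Ideal.subset_span rfl⟩ : N) ∈ I • (⊤ : Submodule T N) :=
    (Submodule.Quotient.mk_eq_zero _).1 hq
  have hmap : x ∈ (I • (⊤ : Submodule T N)).map N.subtype := ⟨_, hmem, rfl⟩
  rw [Submodule.map_smul'', Submodule.map_top, Submodule.range_subtype] at hmap
  obtain ⟨y, hy, hyx⟩ := (Submodule.mem_smul_span_singleton).1 hmap
  exact ⟨y, hy, hyx⟩

/-- A pure ideal consisting of nilpotent elements is zero. [cite: StacksProject, Tag 04PS] -/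
theorem eq_bot_of_flat_quotient_of_le_nilradical (I : Ideal T) [Module.Flat T (T ⧸ I)]
    (hI : ∀ x ∈ I, IsNilpotent x) : I = ⊥ := by
  refine (Submodule.eq_bot_iff _).2 fun x hx => ?_
  obtain ⟨y, hy, hyx⟩ := exists_mul_eq_self_of_flat_quotient I hx
  obtain ⟨n, hn⟩ := hI y hy
  have : ∀ k : ℕ, y ^ k * x = x := by
    intro k
    induction k with
    | zero => simp
    | succ k ih => rw [pow_succ, mul_assoc, hyx, ih]
  rw [← this n, hn, zero_mul]

/-- The kernel of a flat surjective ring map is pure. [cite: StacksProject, Tag 04PS] -/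
theorem exists_mul_eq_self_of_flat_surjective {S : Type*} [CommRing S] (f : T →+* S)
    (hf : Function.Surjective f) (hflat : f.Flat) {x : T} (hx : f x = 0) :
    ∃ y, f y = 0 ∧ y * x = x := by
  letI := f.toAlgebra
  haveI : Module.Flat T S := hflat
  -- `T ⧸ ker f ≃ₗ[T] S`
  let e₀ := RingHom.quotientKerEquivOfSurjective hf
  let e : (T ⧸ RingHom.ker f) ≃ₗ[T] S :=
    { e₀ with
      map_smul' := fun t q => by
        obtain ⟨q, rfl⟩ := Ideal.Quotient.mk_surjective q
        change e₀ (Ideal.Quotient.mk _ (t * q)) = f t * e₀ (Ideal.Quotient.mk _ q)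
        simp [e₀, RingHom.quotientKerEquivOfSurjective, map_mul] }
  haveI : Module.Flat T (T ⧸ RingHom.ker f) := Module.Flat.of_linearEquiv e
  obtain ⟨y, hy, hyx⟩ := exists_mul_eq_self_of_flat_quotient (RingHom.ker f) (x := x) hx
  exact ⟨y, hy, hyx⟩

end Pure

/-! ### Flat diagonal implies formally unramified (Stacks 092L) -/

section Unramified

variable {A B : Type u} [CommRing A] [CommRing B] [Algebra A B]

/-- **If `B ⊗_A B → B` is flat then `Ω_{B/A} = 0`**: the kernel `I` of the multiplication map
is pure, so `I = I²`. [cite: StacksProject, Tag 092L] -/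
theorem formallyUnramified_of_flat_lmul'
    (h : (Algebra.TensorProduct.lmul' A (S := B)).toRingHom.Flat) :
    Algebra.FormallyUnramified A B := by
  have hsurj : Function.Surjective (Algebra.TensorProduct.lmul' A (S := B)).toRingHom :=
    fun b => ⟨b ⊗ₜ 1, by simp⟩
  have hidem : IsIdempotentElem (KaehlerDifferential.ideal A B) := by
    change KaehlerDifferential.ideal A B * KaehlerDifferential.ideal A B = _
    refine le_antisymm Ideal.mul_le_right fun x hx => ?_
    have hx' : (Algebra.TensorProduct.lmul' A (S := B)).toRingHom x = 0 := hx
    obtain ⟨y, hy, hyx⟩ := exists_mul_eq_self_of_flat_surjective _ hsurj h hx'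
    rw [← hyx]
    exact Ideal.mul_mem_mul hy hx
  haveI : Subsingleton Ω[B⁄A] := (Ideal.cotangent_subsingleton_iff _).2 hidem
  exact ⟨inferInstance⟩

/-- A weakly étale algebra is formally unramified. [cite: StacksProject, Tag 092L;
BhattScholze2015, Prop. 2.3.3 (2)] -/
theorem formallyUnramified_of_weaklyEtale [Algebra.WeaklyEtale A B] :
    Algebra.FormallyUnramified A B :=
  formallyUnramified_of_flat_lmul' (Algebra.WeaklyEtale.flat_lmul' A B)

end Unramified

/-! ### Descent of flatness along a faithfully flat map (Stacks 0584) -/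

section Descent

/-- **Flatness of `A → B` descends along a faithfully flat `B → C`**: if `A → B → C` with
`B → C` faithfully flat and `A → C` flat, then `A → B` is flat. [cite: StacksProject, Tag 0584] -/
theorem module_flat_of_faithfullyFlat (A B C : Type*) [CommRing A] [CommRing B] [CommRing C]
    [Algebra A B] [Algebra B C] [Algebra A C] [IsScalarTower A B C] [Module.FaithfullyFlat B C]
    [Module.Flat A C] : Module.Flat A B := by
  rw [Module.Flat.iff_lTensor_injectiveₛ]
  intro P _ _ N
  -- the `B`-linear base change of `N ↪ P`
  have key : Function.Injective ((N.subtype.baseChange B).lTensor C) := by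
    let e₁ := TensorProduct.AlgebraTensorModule.cancelBaseChange A B B C N
    let e₂ := TensorProduct.AlgebraTensorModule.cancelBaseChange A B B C P
    have hcomm : ∀ x, e₂ ((N.subtype.baseChange B).lTensor C x) = (N.subtype.lTensor C) (e₁ x) := by
      intro x
      induction x using TensorProduct.induction_on with
      | zero => simp
      | add x y hx hy => simp [map_add, hx, hy]
      | tmul c y =>
        induction y using TensorProduct.induction_on with
        | zero => simp
        | add y z hy hz =>
          simp only [LinearMap.lTensor_tmul] at hy hz
          simp only [LinearMap.lTensor_tmul, TensorProduct.tmul_add, map_add, hy, hz]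
        | tmul b n => simp [e₁, e₂]
    have hC : Function.Injective (N.subtype.lTensor C) :=
      Module.Flat.lTensor_preserves_injective_linearMap _ Subtype.val_injective
    intro x y hxy
    have := congrArg e₂ hxy
    rw [hcomm, hcomm] at this
    exact e₁.injective (hC this)
  have := (Module.FaithfullyFlat.lTensor_injective_iff_injective B C (N.subtype.baseChange B)).1 key
  intro x y hxy
  exact this hxy

/-- `RingHom` form: if `g : B → C` is faithfully flat and `g ∘ f` is flat then `f` is flat.
[cite: StacksProject, Tag 0584] -/
theorem ringHom_flat_of_comp_faithfullyFlat {A B C : Type*} [CommRing A] [CommRing B]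
    [CommRing C] {f : A →+* B} {g : B →+* C} (hg : g.FaithfullyFlat) (h : (g.comp f).Flat) :
    f.Flat := by
  letI := f.toAlgebra
  letI := g.toAlgebra
  letI := (g.comp f).toAlgebra
  haveI : IsScalarTower A B C := IsScalarTower.of_algebraMap_eq fun _ => rfl
  haveI : Module.FaithfullyFlat B C := hg
  haveI : Module.Flat A C := h
  exact module_flat_of_faithfullyFlat A B C

end Descent

/-! ### Weakly étale algebras over a field: idempotents, reducedness, local ⇒ field -/

section Field

variable (K : Type u) [Field K] (B : Type u) [CommRing B] [Algebra K B]

/-- Over a field, for `B` weakly étale, every `f ∈ B` satisfies `f = c f²` for some `c`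
(`B/(f)` is `B`-flat, Stacks 092C, so `(f)` is pure). [cite: StacksProject, Tags 092C, 092F] -/
theorem exists_mul_mul_eq_self_of_weaklyEtale_field [Algebra.WeaklyEtale K B] (f : B) :
    ∃ c : B, c * f * f = f := by
  haveI : Module.Flat B (B ⧸ Ideal.span {f}) :=
    flat_algebraMap_of_weaklyEtale_left K B (B ⧸ Ideal.span {f})
  obtain ⟨y, hy, hyf⟩ :=
    exists_mul_eq_self_of_flat_quotient (Ideal.span {f}) (Ideal.subset_span rfl)
  obtain ⟨c, rfl⟩ := Ideal.mem_span_singleton'.1 hy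
  exact ⟨c, hyf⟩

/-- Over a field, for `B` weakly étale, **every principal ideal is generated by an idempotent**:
`e = c f` with `f = e f`. [cite: StacksProject, Tag 092F] -/
theorem exists_isIdempotentElem_of_weaklyEtale_field [Algebra.WeaklyEtale K B] (f : B) :
    ∃ e : B, IsIdempotentElem e ∧ (∃ c, e = c * f) ∧ f = e * f := by
  obtain ⟨c, hc⟩ := exists_mul_mul_eq_self_of_weaklyEtale_field K B f
  refine ⟨c * f, ?_, ⟨c, rfl⟩, ?_⟩
  · change c * f * (c * f) = c * f
    calc c * f * (c * f) = c * (c * f * f) := by ring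
      _ = c * f := by rw [hc]
  · exact hc.symm

/-- **A weakly étale algebra over a field is reduced.** [cite: StacksProject, Tags 092F, 092I] -/
theorem isReduced_of_weaklyEtale_field [Algebra.WeaklyEtale K B] : IsReduced B := by
  refine ⟨fun f hf => ?_⟩
  obtain ⟨e, he, ⟨c, rfl⟩, hfe⟩ := exists_isIdempotentElem_of_weaklyEtale_field K B f
  obtain ⟨n, hn⟩ := hf
  have hen : IsNilpotent (c * f) := ⟨n, by rw [mul_pow, hn, mul_zero]⟩
  have he0 : c * f = 0 := by
    obtain ⟨m, hm⟩ := hen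
    cases m with
    | zero => exact eq_zero_of_zero_eq_one (by rw [pow_zero] at hm; exact hm.symm) _
    | succ m => rw [← he.pow_succ_eq m]; exact hm
  rw [hfe, he0, zero_mul]

/-- Over a field, a weakly étale algebra whose only idempotents are `0` and `1` has every
element zero or a unit. [cite: StacksProject, Tag 092Q] -/
theorem eq_zero_or_isUnit_of_weaklyEtale_field [Algebra.WeaklyEtale K B]
    (h : ∀ e : B, IsIdempotentElem e → e = 0 ∨ e = 1) (f : B) : f = 0 ∨ IsUnit f := by
  obtain ⟨e, he, ⟨c, rfl⟩, hfe⟩ := exists_isIdempotentElem_of_weaklyEtale_field K B f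
  rcases h _ he with h0 | h1
  · left; rw [hfe, h0, zero_mul]
  · right; exact IsUnit.of_mul_eq_one_right c h1

/-- **A local weakly étale algebra over a field is a field.** [cite: StacksProject, Tag 092Q] -/
theorem isField_of_weaklyEtale_field [Algebra.WeaklyEtale K B] [IsLocalRing B] : IsField B := by
  refine ⟨⟨0, 1, zero_ne_one⟩, mul_comm, fun {a} ha => ?_⟩
  have hid : ∀ e : B, IsIdempotentElem e → e = 0 ∨ e = 1 := fun e he => by
    rcases IsLocalRing.isUnit_or_isUnit_one_sub_self e with hu | hu
    · right
      have : e * e = e * 1 := by rw [mul_one]; exact he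
      exact hu.mul_left_cancel this
    · left
      have h1 : (1 - e) * e = (1 - e) * 0 := by
        rw [mul_zero, sub_mul, one_mul, he, sub_self]
      exact hu.mul_left_cancel h1
  rcases eq_zero_or_isUnit_of_weaklyEtale_field K B hid a with h0 | hu
  · exact (ha h0).elim
  · exact hu.exists_right_inv

end Field

/-! ### Weakly étale field extensions are separable algebraic (Stacks 092P) -/

section FieldExt

variable (K L : Type u) [Field K] [Field L] [Algebra K L]

/-- An intermediate field of a weakly étale field extension is weakly étale: `E ⊗_K E → L ⊗_K L`
is flat, `L ⊗_K L → L` is flat, and flatness of `E ⊗_K E → E` descends along the faithfully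
flat `E → L`. [cite: StacksProject, Tag 092O] -/
theorem weaklyEtale_intermediateField [Algebra.WeaklyEtale K L] (E : IntermediateField K L) :
    Algebra.WeaklyEtale K E := by
  refine ⟨inferInstance, ?_⟩
  let v : E →ₐ[K] L := E.val
  have hv : v.toRingHom.Flat := by
    have : v.toRingHom = algebraMap E L := rfl
    rw [this, RingHom.flat_algebraMap_iff]
    infer_instance
  have hι : (Algebra.TensorProduct.map v v).toRingHom.Flat := RingHom.Flat.tensorProductMap hv hv
  have hcomp : ((Algebra.TensorProduct.lmul' K (S := L)).toRingHom.comp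
      (Algebra.TensorProduct.map v v).toRingHom).Flat :=
    hι.comp (Algebra.WeaklyEtale.flat_lmul' K L)
  have heq : (Algebra.TensorProduct.lmul' K (S := L)).toRingHom.comp
      (Algebra.TensorProduct.map v v).toRingHom =
      (algebraMap E L).comp (Algebra.TensorProduct.lmul' K (S := E)).toRingHom := by
    have : (Algebra.TensorProduct.lmul' K (S := L)).comp (Algebra.TensorProduct.map v v) =
        (IsScalarTower.toAlgHom K E L).comp (Algebra.TensorProduct.lmul' K (S := E)) := by
      ext a
      · simp [v]
      · simp [v]
    exact congrArg AlgHom.toRingHom this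
  rw [heq] at hcomp
  have hff : (algebraMap E L).FaithfullyFlat := by
    rw [RingHom.faithfullyFlat_algebraMap_iff]; infer_instance
  exact ringHom_flat_of_comp_faithfullyFlat hff hcomp

/-- **A weakly étale field extension is separable (algebraic)**: for `x ∈ L`, `K⟮x⟯` is weakly
étale over `K`, hence formally unramified and essentially of finite type, hence separable.
[cite: StacksProject, Tag 092P] -/
theorem isSeparable_of_weaklyEtale_field [Algebra.WeaklyEtale K L] : Algebra.IsSeparable K L := by
  refine ⟨fun x => ?_⟩
  let E : IntermediateField K L := IntermediateField.adjoin K {x}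
  haveI : Algebra.WeaklyEtale K E := weaklyEtale_intermediateField K L E
  haveI : Algebra.FormallyUnramified K E := formallyUnramified_of_weaklyEtale
  haveI : Algebra.EssFiniteType K E :=
    IntermediateField.essFiniteType_iff.2 (IntermediateField.fg_adjoin_of_finite (Set.finite_singleton x))
  haveI : Algebra.IsSeparable K E := Algebra.FormallyUnramified.isSeparable K E
  let x' : E := ⟨x, IntermediateField.mem_adjoin_simple_self K x⟩
  have hx' : IsSeparable K x' := Algebra.IsSeparable.isSeparable K x'
  have : IsSeparable K (algebraMap E L x') := by
    unfold IsSeparable at hx' ⊢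
    rwa [minpoly.algebraMap_eq (algebraMap E L).injective]
  exact this

/-- A weakly étale field extension is algebraic. [cite: StacksProject, Tag 092P] -/
theorem isAlgebraic_of_weaklyEtale_field [Algebra.WeaklyEtale K L] : Algebra.IsAlgebraic K L :=
  haveI := isSeparable_of_weaklyEtale_field K L
  inferInstance

/-- Over a separably closed field, a weakly étale field extension is trivial.
[cite: StacksProject, Tags 092P, 092Z] -/
theorem bijective_algebraMap_field_of_weaklyEtale_of_isSepClosed [IsSepClosed K]
    [Algebra.WeaklyEtale K L] : Function.Bijective (algebraMap K L) :=
  haveI := isSeparable_of_weaklyEtale_field K L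
  ⟨(algebraMap K L).injective, IsSepClosed.algebraMap_surjective K L⟩

end FieldExt

/-! ### Local weakly étale algebras over separably closed fields -/

section LocalOverField

variable (K : Type u) [Field K] (B : Type u) [CommRing B] [Algebra K B]

/-- **A local weakly étale algebra over a separably closed field `K` is `K`** (the closed fibre
step in Olivier's theorem). [cite: StacksProject, Tags 092Q, 092P, 092Z] -/
theorem bijective_algebraMap_of_weaklyEtale_of_isSepClosed [IsSepClosed K] [Algebra.WeaklyEtale K B]
    [IsLocalRing B] : Function.Bijective (algebraMap K B) := by
  letI : Field B := (isField_of_weaklyEtale_field K B).toField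
  exact bijective_algebraMap_field_of_weaklyEtale_of_isSepClosed K B

/-- Over an arbitrary field: a weakly étale algebra with only trivial idempotents is a field
whose structure map is bijective as soon as `K` is separably closed. [cite: StacksProject,
Tags 092Q, 092P] -/
theorem bijective_algebraMap_of_weaklyEtale_of_idempotents [IsSepClosed K] [Algebra.WeaklyEtale K B]
    [Nontrivial B] (h : ∀ e : B, IsIdempotentElem e → e = 0 ∨ e = 1) :
    Function.Bijective (algebraMap K B) := by
  have hF : IsField B :=
    ⟨exists_pair_ne B, mul_comm, fun {a} ha =>
      ((eq_zero_or_isUnit_of_weaklyEtale_field K B h a).resolve_left ha).exists_right_inv⟩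
  letI : Field B := hF.toField
  exact bijective_algebraMap_field_of_weaklyEtale_of_isSepClosed K B

end LocalOverField

end Literature.RingTheory.Etale
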